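import Literature.Geometry.Symplectic.OrigamiNullFoliation
import HarnessLib

/-!
# The Moser vector of a `1`-form against a `2`-form on `ℝ⁴`, through the Pfaffian adjugate

Ninth proofs companion of `OrigamiUnfolding.lean` (fact seat of
`Literature.Geometry.Symplectic.exists_symplecticCutPieces_of_isOrigamiForm`), step (S1), the Moser
argument near the fold (Cannas da Silva–Guillemin–Woodward 2000, proof of Thm. 1; McDuff–Salamon
2017, §3.2): the Moser vector field solves `ι_v ω_s = -μ`.  In dimension four the inverse of a
non-degenerate `2`-form is its Pfaffian adjugate divided by the Pfaffian (the tree's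
`pfaffAdjCol`, `alt_two_pfaffAdjCol : α(c_k, w) = -Pf(α) w_k` of `OrigamiNullFoliation.lean`),
which is LINEAR in `α`; along a fold `Pf(ω_s) = t π` has a simple zero while the relative
Poincaré primitive `μ = t μ̃` has an explicit factor `t` (`LinearHomotopyOperator.lean`), so the
Moser vector `π⁻¹ Σ_k μ̃(e_k) c_k(ω_s)` is smooth across the fold and vanishes on it.  This file
records the pointwise algebra:

* `alt_two_sum_smul_pfaffAdjCol` — `α(Σ_k c_k • adj_k, w) = -Pf(α) Σ_k c_k w_k`;
* `alt_one_eq_sum` — `μ(w) = Σ_k w_k μ(e_k)`;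
* `alt_two_moserVector` — for `Pf α ≠ 0`, `v = (Pf α)⁻¹ Σ_k μ(e_k) adj_k(α)` solves
  `α(v, w) = -μ(w)` for all `w`;
* `alt_two_moserVector_cancel` — **the cancelled form**: if `Pf α = t π` with `π ≠ 0` and
  `μ = t μ̃`, then `v = π⁻¹ Σ_k μ̃(e_k) adj_k(α)` solves `α(v, w) = -μ(w)` — also at `t = 0`,
  where `v` is whatever the formula gives (no division by `t`).

Everything here is proved; no definitions, no facts.

## References

* A. Cannas da Silva, V. Guillemin, C. Woodward, *On the unfolding of folded symplectic
  structures*, Math. Res. Lett. 7 (2000), proof of Thm. 1. [CannasGuilleminWoodward2000]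
* D. McDuff, D. Salamon, *Introduction to Symplectic Topology*, 3rd ed. (2017), §3.2 (Moser
  isotopy). [McDuffSalamon2017]
-/

noncomputable section

open scoped Manifold
open Set Function

namespace Literature.Geometry.Symplectic

variable (α : (EuclideanSpace ℝ (Fin 4)) [⋀^Fin 2]→L[ℝ] ℝ)

/-- **`α` on a combination of the adjugate columns**: `α(Σ_k c_k adj_k, w) = -Pf(α) Σ_k c_k w_k`.
[folklore] -/
theorem alt_two_sum_smul_pfaffAdjCol (c : Fin 4 → ℝ) (w : EuclideanSpace ℝ (Fin 4)) :
    α ![∑ k, c k • pfaffAdjCol α k, w] = -pfaffian α * ∑ k, c k * w k := by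
  have hlin : ∀ (s : Finset (Fin 4)),
      α ![∑ k ∈ s, c k • pfaffAdjCol α k, w] = ∑ k ∈ s, c k * α ![pfaffAdjCol α k, w] := by
    intro s
    induction s using Finset.induction_on with
    | empty =>
      simp only [Finset.sum_empty]
      exact (α).map_coord_zero 0 rfl
    | insert a s ha ih =>
      rw [Finset.sum_insert ha, Finset.sum_insert ha, alt_two_add_left, alt_two_smul_left, ih]
  rw [hlin, Finset.mul_sum]
  refine Finset.sum_congr rfl fun k _ => ?_
  rw [alt_two_pfaffAdjCol]
  ring

omit α in
/-- A `1`-form on `ℝ⁴` in coordinates: `μ(w) = Σ_k w_k μ(e_k)`. [folklore] -/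
theorem alt_one_eq_sum (μ : (EuclideanSpace ℝ (Fin 4)) [⋀^Fin 1]→L[ℝ] ℝ) (w : EuclideanSpace ℝ (Fin 4)) :
    μ ![w] = ∑ k, w k * μ ![stdVec k] := by
  have hlin : ∀ (s : Finset (Fin 4)) (f : Fin 4 → ℝ),
      μ ![∑ k ∈ s, f k • stdVec k] = ∑ k ∈ s, f k * μ ![stdVec k] := by
    intro s f
    induction s using Finset.induction_on with
    | empty =>
      simp only [Finset.sum_empty]
      exact μ.map_coord_zero 0 rfl
    | insert a s ha ih =>
      rw [Finset.sum_insert ha, Finset.sum_insert ha, μ.vecCons_add ![] _ _, μ.vecCons_smul ![] _ _,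
        smul_eq_mul, ih]
  conv_lhs => rw [← sum_smul_stdVec w]
  exact hlin Finset.univ w

/-- **The Moser vector through the Pfaffian adjugate**: for `Pf α ≠ 0` the vector
`v = (Pf α)⁻¹ Σ_k μ(e_k) adj_k(α)` satisfies `α(v, w) = -μ(w)` for all `w` (`ι_v α = -μ`).
[cite: McDuffSalamon2017, §3.2] -/
theorem alt_two_moserVector (hP : pfaffian α ≠ 0) (μ : (EuclideanSpace ℝ (Fin 4)) [⋀^Fin 1]→L[ℝ] ℝ)
    (w : EuclideanSpace ℝ (Fin 4)) :
    α ![(pfaffian α)⁻¹ • ∑ k, μ ![stdVec k] • pfaffAdjCol α k, w] = -μ ![w] := by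
  rw [alt_two_smul_left, alt_two_sum_smul_pfaffAdjCol, alt_one_eq_sum μ w]
  have h : ∑ k, μ ![stdVec k] * w k = ∑ k, w k * μ ![stdVec k] :=
    Finset.sum_congr rfl fun k _ => mul_comm _ _
  rw [h]
  field_simp

/-- **The cancelled Moser vector across a fold**: if `Pf α = t π` with `π ≠ 0` and `μ = t μ̃`,
then `v = π⁻¹ Σ_k μ̃(e_k) adj_k(α)` satisfies `α(v, w) = -μ(w)` for all `w` — including at
`t = 0` (the simple zero of the Pfaffian cancels against the factor `t` of the primitive; no
division by `t`). [cite: CannasGuilleminWoodward2000, proof of Thm. 1] -/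
theorem alt_two_moserVector_cancel {t c : ℝ} (hc : c ≠ 0) (hP : pfaffian α = t * c)
    {μ ν : (EuclideanSpace ℝ (Fin 4)) [⋀^Fin 1]→L[ℝ] ℝ} (hμ : μ = t • ν)
    (w : EuclideanSpace ℝ (Fin 4)) :
    α ![c⁻¹ • ∑ k, ν ![stdVec k] • pfaffAdjCol α k, w] = -μ ![w] := by
  rw [alt_two_smul_left, alt_two_sum_smul_pfaffAdjCol, hP, hμ, ContinuousAlternatingMap.smul_apply,
    smul_eq_mul, alt_one_eq_sum ν w]
  have h : ∑ k, ν ![stdVec k] * w k = ∑ k, w k * ν ![stdVec k] :=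
    Finset.sum_congr rfl fun k _ => mul_comm _ _
  rw [h]
  field_simp

end Literature.Geometry.Symplectic

end
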